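import Literature.AnabelianGeometry.AbsoluteAnabelian.FundamentalExtensionRestrictionMLFBase
import Literature.NumberTheory.GaloisRepresentations.AbsGaloisGroupProofs
import HarnessLib

/-!
# The restricted MLF base data versus the restriction map `G_{K_U} → G_K`: agreement up to conjugacy

abc-iut cell, layer L4, proof-only sequel of the adapter «MLFBASE-OF-OPEN»
(`FundamentalExtensionRestrictionMLFBase.lean`, writer abc-iut-L4-t11).  The MLF base data
`B.ofOpenSubgroup U` of the restricted extension `E.ofOpenSubgroup U` identify `aug(U)` with
`G_{K_U} = Gal(K̄_Uᵃˡᵍ/K_U)` through the tree's `fixingSubgroupEquivAbsoluteGaloisGroup K_U`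
(`Literature/FieldTheory/Galois/FixingSubgroupAbsoluteGalois.lean`), which rests on ONE choice of a
`K_U`-isomorphism `K̄ ≅ K̄_Uᵃˡᵍ`; the trunk's restriction map
`absGaloisRestrict K K_U : G_{K_U} → G_K` (`Literature/NumberTheory/GaloisRepresentations/AbsGaloisGroup.lean`)
rests on ANOTHER choice, the `K`-embedding `absClosureEmbedding K K_U : K̄ → K̄_Uᵃˡᵍ`.  "The absolute
Galois group is only defined up to an inner automorphism" (Milne, *Fields and Galois Theory*, Ch. 7,
footnote after Prop. 7.6; the tree's `absGaloisRestrict_isConj_of_algHom_holds`): we PROVE that the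
two agree up to conjugation by ONE element `γ ∈ G_K`, independent of the group element —

* `exists_absGaloisRestrict_fixingSubgroupEquivAbsoluteGaloisGroup_eq_conj` (general, any field `k`
  and any subextension `K′ ⊆ k̄`): `res_{K′/k} ∘ (Gal(k̄/K′) ≅ G_{K′}) = γ (·) γ⁻¹` on `Gal(k̄/K′) ≤ G_k`;
* `MLFBase.exists_absGaloisRestrict_galIso_ofOpenSubgroup_eq_conj`: for `g ∈ aug(U)`,
  `res_{K_U/K} ((B.ofOpenSubgroup U).galIso g) = γ · B.galIso g · γ⁻¹`;
* `MLFBase.exists_range_absGaloisRestrict_fixedFieldOfOpen_eq_conj`: the image of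
  `G_{K_U} → G_K` is the conjugate `γ · galImage · γ⁻¹` of the image of `aug(U)` ("the image of the
  induced open homomorphism", [AbsTopIII] Rmk 1.10.1 (iii) p. 44 / Rmk 3.2.2 p. 73).

Proof-only (no definitions); classical Galois theory; nothing here bears on the disputed
[IUTchIII] Cor. 3.12.
-/

noncomputable section

open Topology

universe u

namespace Literature.AnabelianGeometry.AbsoluteAnabelian

open Field
open Literature.NumberTheory.GaloisRepresentations
open Literature.FieldTheory.Galois

/-! ### General: `Gal(k̄/K′) ≅ G_{K′} → G_k` is the inclusion up to conjugacy -/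

section General

variable (k : Type u) [Field k] (K' : IntermediateField k (AlgebraicClosure k))

/-- **`res_{K′/k} ∘ (Gal(k̄/K′) ≅ G_{K′})` is conjugation by a fixed `γ ∈ G_k`.**  For a subextension
`K′ ⊆ k̄` of `k`, the composite of the tree's identification
`fixingSubgroupEquivAbsoluteGaloisGroup K′ : Gal(k̄/K′) ≃ₜ* G_{K′}` with the restriction map
`absGaloisRestrict k K′ : G_{K′} → G_k` differs from the inclusion `Gal(k̄/K′) ≤ Gal(k̄/k) = G_k` by
the inner automorphism of ONE `γ ∈ G_k` (the two constructions use two `k`-embeddings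
`k̄ → K̄′ᵃˡᵍ`, which differ by an element of `G_k`: `absGaloisRestrict_isConj_of_algHom_holds`).
[cite: MilneFT2022, Ch. 7, footnote after Prop. 7.6 (the absolute Galois group is defined up to an inner automorphism)] -/
theorem exists_absGaloisRestrict_fixingSubgroupEquivAbsoluteGaloisGroup_eq_conj :
    ∃ γ : absoluteGaloisGroup k, ∀ σ : K'.fixingSubgroup,
      absGaloisRestrict k K' (fixingSubgroupEquivAbsoluteGaloisGroup K' σ) =
        γ * (absoluteGaloisGroup.toAlgEquiv k).symm σ.1 * γ⁻¹ := by
  haveI : Algebra.IsAlgebraic k (AlgebraicClosure k) := inferInstance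
  -- the `K′`-isomorphism `e : k̄ ≅ K̄′ᵃˡᵍ` behind `fixingSubgroupEquivAbsoluteGaloisGroup K′`
  let e : AlgebraicClosure k ≃ₐ[K'] AlgebraicClosure K' := algEquivAlgebraicClosure K'
  let ι' : AlgebraicClosure k →ₐ[k] AlgebraicClosure K' := e.toAlgHom.restrictScalars k
  -- `r′ τ := e⁻¹ ∘ τ ∘ e ∈ Gal(k̄/K′) ≤ G_k`, the inverse identification
  let r' : absoluteGaloisGroup K' → absoluteGaloisGroup k := fun τ =>
    (absoluteGaloisGroup.toAlgEquiv k).symm ((fixingSubgroupEquivAbsoluteGaloisGroup K').symm τ).1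
  have hr' : ∀ (τ : absoluteGaloisGroup K') (x : AlgebraicClosure k), ι' (r' τ • x) = τ • ι' x := by
    intro τ x
    change e (e.symm ((absoluteGaloisGroup.toAlgEquiv K' τ) (e x))) = (absoluteGaloisGroup.toAlgEquiv K' τ) (e x)
    exact e.apply_symm_apply _
  obtain ⟨γ, hγ⟩ := absGaloisRestrict_isConj_of_algHom_holds k K' ι' r' hr'
  refine ⟨γ⁻¹, fun σ => ?_⟩
  have h := hγ (fixingSubgroupEquivAbsoluteGaloisGroup K' σ)
  have hrσ : r' (fixingSubgroupEquivAbsoluteGaloisGroup K' σ) = (absoluteGaloisGroup.toAlgEquiv k).symm σ.1 := by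
    change (absoluteGaloisGroup.toAlgEquiv k).symm
        ((fixingSubgroupEquivAbsoluteGaloisGroup K').symm (fixingSubgroupEquivAbsoluteGaloisGroup K' σ)).1 = _
    rw [ContinuousMulEquiv.symm_apply_apply]
  rw [hrσ] at h
  rw [inv_inv, h]
  group

end General

/-! ### The restricted MLF base data -/

namespace FundamentalExtension

namespace MLFBase

variable {E : FundamentalExtension.{u}} (B : E.MLFBase) (U : OpenSubgroup E.arith)

/-- **`res_{K_U/K} ∘ (B.ofOpenSubgroup U).galIso = γ · B.galIso · γ⁻¹` on `aug(U)`** for ONE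
`γ ∈ G_K`: the Galois identification of the restricted MLF base data is compatible with `B.galIso`
and the trunk's restriction map `absGaloisRestrict K K_U : G_{K_U} → G_K` up to a single inner
automorphism of `G_K` ([AbsTopIII] Thm 1.9 p. 38: functoriality in "open injective homomorphisms of
extensions of profinite groups"; the conjugacy indeterminacy is that of the absolute Galois group
itself). [cite: MochizukiAbsTopIII2015, Thm 1.9 p.38] -/
theorem exists_absGaloisRestrict_galIso_ofOpenSubgroup_eq_conj :
    ∃ γ : absoluteGaloisGroup B.K, ∀ g : (E.ofOpenSubgroup U).gal,
      absGaloisRestrict B.K (B.fixedFieldOfOpen U) ((B.ofOpenSubgroup U).galIso g) =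
        γ * B.galIso g.1 * γ⁻¹ := by
  obtain ⟨γ, hγ⟩ :=
    exists_absGaloisRestrict_fixingSubgroupEquivAbsoluteGaloisGroup_eq_conj B.K (B.fixedFieldOfOpen U)
  exact ⟨γ, fun g => hγ (B.galImageEquivFixingSubgroup U (B.galIsoRestrict U g))⟩

/-- **The image of `G_{K_U} → G_K` is a conjugate of the image of `aug(U)`**: for the `γ` above,
`res_{K_U/K}(G_{K_U}) = γ · galImage · γ⁻¹` ("the image of the induced open homomorphism on
arithmetic Galois groups", [AbsTopIII] Rmk 3.2.2 p. 73; of index `[G : aug(U)]` by `index_galImage`).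
[cite: MochizukiAbsTopIII2015, Remark 3.2.2 p.73] -/
theorem exists_range_absGaloisRestrict_fixedFieldOfOpen_eq_conj :
    ∃ γ : absoluteGaloisGroup B.K,
      (absGaloisRestrict B.K (B.fixedFieldOfOpen U)).range =
        (B.galImage U).map (MulAut.conj γ).toMonoidHom := by
  obtain ⟨γ, hγ⟩ := B.exists_absGaloisRestrict_galIso_ofOpenSubgroup_eq_conj U
  refine ⟨γ, Subgroup.ext fun δ => ?_⟩
  constructor
  · rintro ⟨τ, rfl⟩
    obtain ⟨g, rfl⟩ := (B.ofOpenSubgroup U).galIso.surjective τ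
    refine ⟨B.galIso g.1, ⟨g.1, g.2, rfl⟩, ?_⟩
    change γ * B.galIso g.1 * γ⁻¹ = _
    exact (hγ g).symm
  · rintro ⟨β, ⟨g, hg, rfl⟩, rfl⟩
    refine ⟨(B.ofOpenSubgroup U).galIso ⟨g, hg⟩, ?_⟩
    change _ = γ * B.galIso g * γ⁻¹
    exact hγ ⟨g, hg⟩

/-- The image of `G_{K_U} → G_K` has index `[G : aug(U)]` in `G_K` (conjugate of `galImage`).
[cite: MochizukiAbsTopIII2015, Remark 1.10.1 (iii) p.44] -/
theorem index_range_absGaloisRestrict_fixedFieldOfOpen :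
    (absGaloisRestrict B.K (B.fixedFieldOfOpen U)).range.index = (E.augImage U).toSubgroup.index := by
  obtain ⟨γ, hγ⟩ := B.exists_range_absGaloisRestrict_fixedFieldOfOpen_eq_conj U
  rw [hγ, ← B.index_galImage U]
  exact Subgroup.index_map_equiv (B.galImage U) (MulAut.conj γ)

end MLFBase

end FundamentalExtension

end Literature.AnabelianGeometry.AbsoluteAnabelian

end
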